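import Summits.HodgeConjecture.HodgeConjecture.Theorems.Ring2AbelianAllAndreCMTwistedSquareWeilType
import HarnessLib

/-!
# Ring 2 · AbelianAll — ANDRÉ AXIS, PART S-h: PRODUCTS AND CONJUGATES OF WEIL-TYPE CM DATA — `a_ρ(A × B, α × β) = a_ρ(A, α) + a_ρ(B, β)`; the conjugate
  structure `(A, −η)` and the product `(A × B, η_A × η_B)` of Weil-type data relative to the CM field `E` are of Weil type (the CM-field forms of the
  tree's imaginary-quadratic `IsWeilType.neg` / `IsWeilType.prod`; abelian-variety level, fact-free)

HONEST FRAMING (page 1, verbatim): **research route, not a corollary; conditional on HC_CM plus one named minimal statement.** Cell line: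
research route conditional on HC_CM; not a corollary; Q11.4-sentence-2 already refuted in dim ≥ 3. `HC_CM`, `HC_AV`, the global nodes do NOT
occur; no pencil occurs; nothing here is a case of the Hodge conjecture. No definition, no named fact, no `sorry`. Seat `pub-hodge-ring2-ab-andre-2`,
gen 49 (part S, abelian-variety bookkeeping behind part S-c). The tree has the imaginary-quadratic statements `HodgeTheory.IsWeilType.neg`
(`(A, −φ)` is of Weil type `(n, d)`) and `HodgeTheory.IsWeilType.prod` (Moonen–Zarhin (1.9): multiplicities `(n₁, n₁) + (n₂, n₂)`); here the same on
Deligne's carriers `IsWeilTypeCM A η R e₀ k` for a CM field `E = ℚ[T]/(R(T²))` of any degree, from part S-c's `Q(α × β) = Q(α) × Q(β)` and the tree's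
`finrank_eigenspace_inf_hodgeOneZero_prod` / `eigenspace_map_neg_one_eq`.

## Content (theorems only; standard axioms)

* `eigenMultiplicity_prodMap` — `a_ρ(A × B, α × β) = a_ρ(A, α) + a_ρ(B, β)` for every `ρ` (the `eigenMultiplicity`-level form of the tree's finrank lemma).
* `eigenMultiplicity_neg` — `a_ρ(A, −η) = a_{−ρ}(A, η)`.
* **`isWeilTypeCM_neg`** — `IsWeilTypeCM A η R e₀ k ⟹ IsWeilTypeCM A (−η) R e₀ k` (the conjugate `E`-structure `ῑ = ι ∘ c`: at a root `ρ`,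
  `a_ρ(−η) = a_{−ρ}(η) = a_ρ̄(η) = k`); `isWeilTypeCM_neg_iff`.
* **`isWeilTypeCM_prod`** — `IsWeilTypeCM A η_A R e₀ k₁`, `IsWeilTypeCM B η_B R e₀ k₂ ⟹ IsWeilTypeCM (A × B) (η_A × η_B) R e₀ (k₁ + k₂)`
  (`R((η_A × η_B)²) = R(η_A²) × R(η_B²) = 0`, `dim = 2(k₁ + k₂)e₀`, `a_ρ = k₁ + k₂`); hence `isWeilTypeCM_prod_neg` — `A × B̄` for two Weil-type data
  — and part S-c's `isWeilTypeCM_twistedSquare_of_isWeilTypeCM` re-derived as `isWeilTypeCM_prod_neg hW hW`.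

## Honest status

Abelian-variety bookkeeping, fact-free; serves the member hypotheses of the CM-field pencil rows for product / conjugate charts (as the quadratic
`IsWeilType.prod` serves parts XLVIII / M-d). Nothing minimal claimed; N104 untouched. EDGE LABELS: all theorems K.
References: Deligne1982HodgeCycles (§4 (4.4), Prop. 4.4; §5 (c) p. 38); MoonenZarhin1999LowDim ((1.9)); MoonenZarhin1998WeilClasses (§1);
vanGeemen1994HodgeAV (4.9, proof of Lemma 5.2 (3)).
-/

noncomputable section

set_option linter.dupNamespace false

namespace Summit.HodgeConjecture.HodgeConjecture.Ring2.AbelianAll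

open CategoryTheory Polynomial
open Literature.AlgebraicTopology.SingularHomology
open Literature.AlgebraicGeometry Literature.AlgebraicGeometry.Motives
open Literature.AlgebraicGeometry.HodgeTheory Literature.AlgebraicGeometry.Deligne1982

variable {A B : AbelianVariety ℂ} {η : A ⟶ A} {ηB : B ⟶ B} {R : Polynomial ℤ} {e₀ k k₁ k₂ : ℕ}

/-- **The multiplicities add over products: `a_ρ(A × B, α × β) = a_ρ(A, α) + a_ρ(B, β)`** (the tree's `finrank_eigenspace_inf_hodgeOneZero_prod`,
restated for `eigenMultiplicity`, whose ambient dimension is `(A × B).dim`). [cite: vanGeemen1994HodgeAV, proof of Lemma 5.2 (3)] [cite: MoonenZarhin1999LowDim, (1.9)] -/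
theorem eigenMultiplicity_prodMap (α : A ⟶ A) (β : B ⟶ B) (ρ : ℂ) :
    eigenMultiplicity (A.prod B) (AbelianVariety.prodLift (AbelianVariety.fst A B ≫ α) (AbelianVariety.snd A B ≫ β)) ρ =
      eigenMultiplicity A α ρ + eigenMultiplicity B β ρ := by
  have hdim : (A.prod B).dim = A.dim + B.dim := AbelianVariety.dim_prod A B
  have h := finrank_eigenspace_inf_hodgeOneZero_prod (A := A) (B := B) rfl rfl α β ρ
  unfold eigenMultiplicity
  rw [← hodgeOneZero_eq_of_dim_eq hdim (Motives.isSmoothProjective_of_dim_eq' hdim)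
    (Motives.AbelianVariety.isSmoothProjective_holds (A := A.prod B))]
  exact h

/-- **`a_ρ(A, −η) = a_{−ρ}(A, η)`** (`ker((−η)^* − ρ) = ker(η^* + ρ)`). [cite: vanGeemen1994HodgeAV, 4.9] -/
theorem eigenMultiplicity_neg (η : A ⟶ A) (ρ : ℂ) : eigenMultiplicity A (-η) ρ = eigenMultiplicity A η (-ρ) := by
  unfold eigenMultiplicity
  rw [eigenspace_map_neg_one_eq η ρ]

/-- **THE CONJUGATE `E`-STRUCTURE IS OF WEIL TYPE**: `IsWeilTypeCM A η R e₀ k ⟹ IsWeilTypeCM A (−η) R e₀ k` (`ῑ = ι ∘ c`, `c(η) = −η`: `R((−η)²) = R(η²) = 0`,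
and at a root `ρ` of `R(T²)`, `a_ρ(−η) = a_{−ρ}(η) = a_ρ̄(η) = k` since `ρ̄ = −ρ` is again a root). The CM-field form of the tree's `IsWeilType.neg`.
[cite: Deligne1982HodgeCycles, §4 (4.4) and Prop. 4.4] [cite: vanGeemen1994HodgeAV, 4.9] -/
theorem isWeilTypeCM_neg (hW : IsWeilTypeCM A η R e₀ k) : IsWeilTypeCM A (-η) R e₀ k where
  e₀_pos := hW.e₀_pos
  k_pos := hW.k_pos
  monic := hW.monic
  natDegree_eq := hW.natDegree_eq
  irreducible := hW.irreducible
  root_real_neg := hW.root_real_neg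
  eval₂_eq_zero := eval₂_neg_comp_X_sq_eq_zero hW.eval₂_eq_zero
  dim_eq := hW.dim_eq
  multiplicity_eq ρ hρ := by
    rw [eigenMultiplicity_neg]
    exact hW.multiplicity_eq (-ρ) (hW.neg_root hρ)

/-- `(A, −η)` is of Weil type `(R, e₀, k)` iff `(A, η)` is. [cite: Deligne1982HodgeCycles, §4 (4.4)] -/
theorem isWeilTypeCM_neg_iff : IsWeilTypeCM A (-η) R e₀ k ↔ IsWeilTypeCM A η R e₀ k :=
  ⟨fun h => by simpa using isWeilTypeCM_neg h, fun h => isWeilTypeCM_neg h⟩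

/-- **THE PRODUCT OF TWO WEIL-TYPE DATA RELATIVE TO THE SAME CM FIELD IS OF WEIL TYPE: multiplicities `k₁ + k₂`.** If `(A, η_A)` is of Weil type
`(R, e₀, k₁)` and `(B, η_B)` of Weil type `(R, e₀, k₂)`, then `(A × B, η_A × η_B)` is of Weil type `(R, e₀, k₁ + k₂)`: `R` kills `(η_A × η_B)²` factor by
factor (part S-c's `eval₂_prodLift_map`), `dim (A × B) = 2(k₁ + k₂)e₀`, and `a_ρ(A × B) = a_ρ(A) + a_ρ(B) = k₁ + k₂`. The CM-field form of the tree's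
`IsWeilType.prod` (Moonen–Zarhin (1.9): `W_K(X₁ × X₂) = W_K(X₁) ⊗_K W_K(X₂)`). [cite: MoonenZarhin1999LowDim, (1.9)] [cite: Deligne1982HodgeCycles, §4 (4.4) and §5 (c) p. 38] -/
theorem isWeilTypeCM_prod (hA : IsWeilTypeCM A η R e₀ k₁) (hB : IsWeilTypeCM B ηB R e₀ k₂) :
    IsWeilTypeCM (A.prod B) (AbelianVariety.prodLift (AbelianVariety.fst A B ≫ η) (AbelianVariety.snd A B ≫ ηB)) R e₀ (k₁ + k₂) where
  e₀_pos := hA.e₀_pos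
  k_pos := Nat.add_pos_left hA.k_pos k₂
  monic := hA.monic
  natDegree_eq := hA.natDegree_eq
  irreducible := hA.irreducible
  root_real_neg := hA.root_real_neg
  eval₂_eq_zero := by
    rw [eval₂_prodLift_map, hA.eval₂_eq_zero, hB.eval₂_eq_zero]
    show (AbelianVariety.prodLift (AbelianVariety.fst A B ≫ (0 : A ⟶ A)) (AbelianVariety.snd A B ≫ (0 : B ⟶ B)) :
        A.prod B ⟶ A.prod B) = 0
    exact AbelianVariety.prod_hom_ext
      (by rw [AbelianVariety.prodLift_fst, Limits.comp_zero, Limits.zero_comp])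
      (by rw [AbelianVariety.prodLift_snd, Limits.comp_zero, Limits.zero_comp])
  dim_eq := by rw [AbelianVariety.dim_prod, hA.dim_eq, hB.dim_eq]; ring
  multiplicity_eq ρ hρ := by
    rw [eigenMultiplicity_prodMap, hA.multiplicity_eq ρ hρ, hB.multiplicity_eq ρ hρ]

/-- **`A × B̄`**: the product of a Weil-type datum with the CONJUGATE of another is of Weil type `(R, e₀, k₁ + k₂)`.
[cite: MoonenZarhin1999LowDim, (1.9)] [cite: Deligne1982HodgeCycles, §4 (4.4)] -/
theorem isWeilTypeCM_prod_neg (hA : IsWeilTypeCM A η R e₀ k₁) (hB : IsWeilTypeCM B ηB R e₀ k₂) :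
    IsWeilTypeCM (A.prod B) (AbelianVariety.prodLift (AbelianVariety.fst A B ≫ η) (AbelianVariety.snd A B ≫ (-ηB))) R e₀ (k₁ + k₂) :=
  isWeilTypeCM_prod hA (isWeilTypeCM_neg hB)

/-- Part S-c's `isWeilTypeCM_twistedSquare_of_isWeilTypeCM` re-derived: `T × T̄ = T × (T, −η)` for `T` of Weil type `(R, e₀, k)` is of Weil type
`(R, e₀, k + k)`. (Part S-c's `isWeilTypeCM_twistedSquare` is stronger: no Weil type on `T`.) [cite: Deligne1982HodgeCycles, §4 (4.4)] -/
theorem isWeilTypeCM_twistedSquare_of_isWeilTypeCM' (hW : IsWeilTypeCM A η R e₀ k) :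
    IsWeilTypeCM (A.prod A) (AbelianVariety.prodLift (AbelianVariety.fst A A ≫ η) (AbelianVariety.snd A A ≫ (-η))) R e₀ (k + k) :=
  isWeilTypeCM_prod_neg hW hW

end Summit.HodgeConjecture.HodgeConjecture.Ring2.AbelianAll

end
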